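import Literature.MathematicalPhysics.QuantumLattice.XYOrderProofs
import Literature.Probability.LatticeModels.ReflectionPositivity
import Mathlib.LinearAlgebra.Matrix.Kronecker
import HarnessLib

/-!
# Kennedy–Lieb–Shastry, XY model: reflections of the even torus (the objects of the proof of (GD))

Trunk T-QLATTICE. Definitions for the proof of ground-state Gaussian domination for the XY
field Hamiltonian `H(h) = H - Σ (h_x - h_y)(S¹_x - S¹_y) + ½Σ(h_x - h_y)²`
(`kls_xy_gaussianDomination_ground`, `XYOrderInfrared.lean`) along Kennedy–Lieb–Shastry,
J. Stat. Phys. 53 (1988) 1019–1030, pp. 1027–1029: the pair of reflection planes `P` through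
the midpoints of the bonds in direction `j` between the layers `xⱼ = a`, `a + 1` and
`xⱼ = a + L/2`, `a + L/2 + 1` of the torus `(ℤ/Lℤ)^d` (`L` even) are the tree's reflection
between sites `θ = Torus.reflectBetweenSites j a` and half-torus `Torus.halfBetweenSites j a`
(`Literature/Probability/LatticeModels/ReflectionPositivity.lean`; the half is repackaged as the
`Finset` `torusLeftHalf`, `coe_torusLeftHalf`, and the named fact `Torus.reflect_maps_half_compl`
of that file is discharged here); on top of them: the reflected fields `h^L`, `h^R`
(`reflectFieldLeft`, `reflectFieldRight`), the number of bonds with `h_x ≠ h_y` (`badBondCount`),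
the field Hamiltonian after the sublattice rotation making all its matrix elements real and all
bond terms ferromagnetic in the real spin matrices `T¹ = S¹`, `T² = iS²`
(`xyRealBond`, `xyRealFieldHamiltonian`; [KLS1988JSP] eqs. (15)–(17), XY version), and the
identification of the state space with the tensor square of the left half along `θ`
(`torusToLeft`, `torusSplit`) under which that Hamiltonian takes the Kronecker form
`H^L ⊗ 1 + 1 ⊗ H^R - Σᵢ Mᵢ ⊗ Nᵢ` of [KLS1988JSP] eq. (21) (`xyLeftHamiltonian`, `xyCrossOp`).
All proofs are in the sibling `XYOrderGDProofs.lean`.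

## References

* [KLS1988JSP] T. Kennedy, E. H. Lieb, B. S. Shastry, *Existence of Néel order in some spin-½
  Heisenberg antiferromagnets*, J. Stat. Phys. 53 (1988) 1019–1030, pp. 1027–1029.
* [DLS1978] F. J. Dyson, E. H. Lieb, B. Simon, J. Stat. Phys. 18 (1978) 335–383, §2–§4
  (reflections in planes between lattice sites; sublattice rotations).
-/

noncomputable section

open Matrix Finset
open scoped Kronecker
open Literature.MathematicalPhysics.QuantumLattice Literature.Probability.LatticeModels

namespace Literature.MathematicalPhysics.QuantumLattice

variable {d : ℕ}

/-! ### The reflection and the two halves -/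

/-- The left half of the torus cut by the planes `P` (`θ = Torus.reflectBetweenSites j a`): the
sites with `xⱼ ∈ {a + 1, …, a + L/2}`, as a `Finset` (it is the tree's half-torus
`Torus.halfBetweenSites j a`, `coe_torusLeftHalf`; the `Finset` form carries the sums and the
finite types of the proof). [Kennedy–Lieb–Shastry, J. Stat. Phys. 53 (1988), p. 1027]
[cite: KLS1988JSP, p. 1027] -/
def torusLeftHalf (L : ℕ) [NeZero L] (j : Fin d) (a : ZMod L) : Finset (TorusSite d L) :=
  univ.filter fun x => (x j - (a + 1)).val < L / 2

/-- The field `h^L`: it agrees with `h` on the left half and is the reflection of `h|_left` on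
the right half. [Kennedy–Lieb–Shastry, J. Stat. Phys. 53 (1988), p. 1029 ("The `h^L` is
defined analogously")] [cite: KLS1988JSP, p. 1029] -/
def reflectFieldLeft (L : ℕ) [NeZero L] (j : Fin d) (a : ZMod L) (h : TorusSite d L → ℝ) :
    TorusSite d L → ℝ :=
  fun y => if y ∈ torusLeftHalf L j a then h y else h (Torus.reflectBetweenSites j a y)

/-- The field `h^R`: it agrees with `h` on the right half and is the reflection of `h|_right` on
the left half. [Kennedy–Lieb–Shastry, J. Stat. Phys. 53 (1988), p. 1029 ("Let `h^R_x` denote the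
function which agrees with `h̄_x` on the right sites and on the left sites equals the reflection
of `h̄_x` in the planes P")] [cite: KLS1988JSP, p. 1029] -/
def reflectFieldRight (L : ℕ) [NeZero L] (j : Fin d) (a : ZMod L) (h : TorusSite d L → ℝ) :
    TorusSite d L → ℝ :=
  fun y => if y ∈ torusLeftHalf L j a then h (Torus.reflectBetweenSites j a y) else h y

open Classical in
/-- The number of bonds `{x, y}` of the torus with `h_x ≠ h_y` (the quantity minimised in the
descent of Kennedy–Lieb–Shastry, J. Stat. Phys. 53 (1988), p. 1027: "we choose a minimizing
configuration `h̄` with the least number of bonds `{xy}` with `h̄_x ≠ h̄_y`").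
[cite: KLS1988JSP, p. 1027] -/
def badBondCount (L : ℕ) [NeZero L] (h : TorusSite d L → ℝ) : ℕ :=
  ((torusGraph d L).edgeFinset.filter fun e => ¬ (e.map h).IsDiag).card

/-! ### The field Hamiltonian after the sublattice rotation -/

section RealBond

variable {Λ : Type*} [Fintype Λ] [DecidableEq Λ]

/-- The bond term of the rotated field Hamiltonian:
`τ_h(x, y) = -½(S¹_xS¹_y + S¹_yS¹_x) + ½(S²_xS²_y + S²_yS²_x) - (h_x - h_y)(S¹_x - S¹_y) + ½(h_x - h_y)²`,
i.e. `½(T¹_x - T¹_y - h_x + h_y)² + ½(T²_x - T²_y)² - ½((T¹_x)² + (T¹_y)² + (T²_x)² + (T²_y)²)`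
with the real matrices `T¹ = S¹`, `T² = iS²` — the XY analogue of the summand of
[KLS1988JSP] eq. (17) (field on the first component; only that component is completed to a
square, cf. `xyFieldHamiltonian`), after the rotation by `π` about the `1`-axis on one
sublattice which turns `-S²_xS²_y` into `+S²_xS²_y = -T²_xT²_y` ([KLS1988JSP] eqs. (15)–(16);
Dyson–Lieb–Simon 1978 §2). Symmetric in `x`, `y`; on any finite site set.
[cite: KLS1988JSP, eqs. (15)–(17)] -/
def xyRealBond (n : ℕ) (h : Λ → ℝ) (x y : Λ) : Op Λ (n + 1) :=
  -spinBond n 0 x y + spinBond n 1 x y -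
    ((h x - h y : ℝ) : ℂ) • (siteSpin n x 0 - siteSpin n y 0) +
    (((h x - h y) ^ 2 / 2 : ℝ) : ℂ) • 1

end RealBond

/-- The rotated field Hamiltonian `H♭(h) = Σ_{⟨xy⟩} τ_h(x, y)` of the XY torus (sum over the
edges of the torus graph). For even side `L ≥ 4` (as in `kls_xy_gaussianDomination_ground`; the
torus must be bipartite for the sublattice rotation to exist) it is unitarily equivalent to
`xyFieldHamiltonian L n h` (proof file); all its matrix elements in the tensor basis are real.
[cite: KLS1988JSP, eqs. (16)–(17)] -/
def xyRealFieldHamiltonian (L : ℕ) [NeZero L] (n : ℕ) (h : TorusSite d L → ℝ) :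
    Op (TorusSite d L) (n + 1) :=
  ∑ e ∈ (torusGraph d L).edgeFinset,
    Sym2.lift ⟨fun x y => xyRealBond n h x y, fun x y => by
      simp only [xyRealBond, spinBond_comm n _ x y]
      congr 2
      · rw [← neg_sub (h y) (h x), Complex.ofReal_neg, neg_smul, ← smul_neg, neg_sub]
      · rw [← neg_sub (h y) (h x), neg_sq]⟩ e

/-! ### The left half as a site set, and the tensor-square identification -/

section Halves

variable (L : ℕ) [NeZero L] (j : Fin d) (a : ZMod L)

/-- Membership in the left half, unfolded. [folklore] -/
theorem mem_torusLeftHalf {x : TorusSite d L} :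
    x ∈ torusLeftHalf L j a ↔ (x j - (a + 1)).val < L / 2 := by
  simp [torusLeftHalf]

omit [NeZero L] in
/-- The `j`-th coordinate of `θx`, `θ = Torus.reflectBetweenSites j a`, measured from the bottom
layer of the left half: `(θx)ⱼ - (a+1) = -((xⱼ - (a+1)) + 1)`. [folklore] -/
theorem reflectBetweenSites_apply_sub (x : TorusSite d L) :
    Torus.reflectBetweenSites j a x j - (a + 1) = -((x j - (a + 1)) + 1) := by
  simp only [Torus.reflectBetweenSites_apply, Function.update_self]
  ring

/-- For even `L`, `t ↦ -(t + 1)` exchanges `{t : val t < L/2}` and its complement in `ℤ/Lℤ`.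
[folklore] -/
theorem val_neg_add_one_lt_iff (hL : Even L) (t : ZMod L) :
    (-(t + 1)).val < L / 2 ↔ ¬ t.val < L / 2 := by
  obtain ⟨k, hk⟩ := hL
  have hL0 : 0 < L := Nat.pos_of_ne_zero (NeZero.ne L)
  haveI : Fact (1 < L) := ⟨by omega⟩
  have ht : t.val < L := ZMod.val_lt t
  rw [ZMod.neg_val', ZMod.val_add, ZMod.val_one]
  by_cases hv : t.val + 1 < L
  · rw [Nat.mod_eq_of_lt hv, Nat.mod_eq_of_lt (by omega)]
    omega
  · have hv' : t.val + 1 = L := by omega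
    rw [hv', Nat.mod_self, Nat.sub_zero, Nat.mod_self]
    omega

/-- For even `L`, the reflection exchanges the two halves: `θx` is in the left half iff `x` is
not (the content of the named fact `Torus.reflect_maps_half_compl` of
`ReflectionPositivity.lean`, discharged below). [Kennedy–Lieb–Shastry, J. Stat. Phys. 53 (1988),
p. 1027; Biskup 2009 §5.1] [folklore] -/
theorem reflectBetweenSites_mem_torusLeftHalf_iff (hL : Even L) (x : TorusSite d L) :
    Torus.reflectBetweenSites j a x ∈ torusLeftHalf L j a ↔ x ∉ torusLeftHalf L j a := by
  rw [mem_torusLeftHalf, mem_torusLeftHalf, reflectBetweenSites_apply_sub,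
    val_neg_add_one_lt_iff L hL]

/-- **The left half is the tree's half-torus** `Torus.halfBetweenSites j a = {x | 1 ≤ (xⱼ - a).val
≤ L/2}` (`(xⱼ - (a+1)).val < L/2 ↔ 1 ≤ (xⱼ - a).val ≤ L/2` in `ℤ/Lℤ`). [folklore] -/
theorem coe_torusLeftHalf :
    ((torusLeftHalf L j a : Finset (TorusSite d L)) : Set (TorusSite d L)) =
      Torus.halfBetweenSites j a := by
  ext x
  rw [Finset.mem_coe, mem_torusLeftHalf, Torus.halfBetweenSites, Set.mem_setOf_eq]
  have hL0 : 0 < L := Nat.pos_of_ne_zero (NeZero.ne L)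
  have hu : (x j - a).val < L := ZMod.val_lt _
  have ht : x j - (a + 1) = (x j - a) - 1 := by ring
  rw [ht]
  by_cases hL1 : L = 1
  · subst hL1
    have h0 : (x j - a).val = 0 := by omega
    have h1 : (x j - a - 1).val = 0 := by have := ZMod.val_lt (x j - a - 1); omega
    rw [h0, h1]
    decide
  haveI : Fact (1 < L) := ⟨by omega⟩
  by_cases h0 : (x j - a).val = 0
  · have hz : x j - a = 0 := (ZMod.val_eq_zero _).1 h0
    rw [hz, zero_sub, ZMod.neg_val', ZMod.val_one, Nat.mod_eq_of_lt (by omega), ZMod.val_zero]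
    omega
  · rw [ZMod.val_sub (by rw [ZMod.val_one]; omega), ZMod.val_one]
    omega

end Halves

end Literature.MathematicalPhysics.QuantumLattice

/-! ### Discharge of `Torus.reflect_maps_half_compl` -/

namespace Literature.MathematicalPhysics.QuantumLattice.Torus


variable {d L : ℕ} [NeZero L]

/-- **Discharge of the named fact `Torus.reflect_maps_half_compl`** (`ReflectionPositivity.lean`):
for even `L`, the reflection between sites maps the positive half-torus onto its complement,
`θ(𝕋⁺) = (𝕋⁺)ᶜ` (Biskup 2009 §5.1). [cite: Biskup2009, §5.1] -/
theorem reflect_maps_half_compl_holds : Torus.reflect_maps_half_compl (d := d) (L := L) := by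
  intro hL i k
  ext x
  rw [← coe_torusLeftHalf, Set.mem_compl_iff, Finset.mem_coe, Set.mem_image]
  constructor
  · rintro ⟨y, hy, rfl⟩
    rw [Finset.mem_coe] at hy
    exact fun h => (reflectBetweenSites_mem_torusLeftHalf_iff L i k hL y).1 h hy
  · intro hx
    refine ⟨Torus.reflectBetweenSites i k x, ?_, Torus.reflectBetweenSites_involutive i k x⟩
    rw [Finset.mem_coe]
    exact (reflectBetweenSites_mem_torusLeftHalf_iff L i k hL x).2 hx

end Literature.MathematicalPhysics.QuantumLattice.Torus

namespace Literature.MathematicalPhysics.QuantumLattice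

variable {d : ℕ}

section Halves

variable (L : ℕ) [NeZero L] (j : Fin d) (a : ZMod L)

/-- The projection of the torus onto its left half along `θ`: `x ↦ x` on the left half,
`x ↦ θx` on the right half (even `L`). Through it, operators on the right half are read as
operators on the left half ("`X^{R,i}` with `xᵢ` replaced by `yᵢ`", Kennedy–Lieb–Shastry,
J. Stat. Phys. 53 (1988), p. 1028). [cite: KLS1988JSP, p. 1028] -/
def torusToLeft (hL : Even L) (x : TorusSite d L) : torusLeftHalf L j a :=
  if hx : x ∈ torusLeftHalf L j a then ⟨x, hx⟩
  else ⟨Torus.reflectBetweenSites j a x, (reflectBetweenSites_mem_torusLeftHalf_iff L j a hL x).2 hx⟩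

variable {q : ℕ}

/-- **The tensor-square identification.** A spin configuration `σ` on the torus is the pair
(`σ` on the left half, `σ ∘ θ` on the left half): the basis `ψ^L_α ⊗ ψ^R_β` of
Kennedy–Lieb–Shastry, J. Stat. Phys. 53 (1988), p. 1027, with the right factor indexed through
the reflection. [cite: KLS1988JSP, p. 1027] -/
def torusSplit (hL : Even L) :
    TensorIndex (TorusSite d L) q ≃ (torusLeftHalf L j a → Fin q) × (torusLeftHalf L j a → Fin q)
    where
  toFun σ := (fun x => σ x, fun x => σ (Torus.reflectBetweenSites j a x))
  invFun p y := if hy : y ∈ torusLeftHalf L j a then p.1 ⟨y, hy⟩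
    else p.2 ⟨Torus.reflectBetweenSites j a y,
      (reflectBetweenSites_mem_torusLeftHalf_iff L j a hL y).2 hy⟩
  left_inv σ := by
    funext y
    dsimp only
    by_cases hy : y ∈ torusLeftHalf L j a
    · rw [dif_pos hy]
    · rw [dif_neg hy, Torus.reflectBetweenSites_involutive j a y]
  right_inv p := by
    rcases p with ⟨α, β⟩
    ext x
    · dsimp only
      rw [dif_pos x.2]
    · have hx : Torus.reflectBetweenSites j a x ∉ torusLeftHalf L j a := fun h =>
        ((reflectBetweenSites_mem_torusLeftHalf_iff L j a hL x).1 h) x.2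
      dsimp only
      rw [dif_neg hx]
      have hxx : (⟨Torus.reflectBetweenSites j a (Torus.reflectBetweenSites j a x),
          (reflectBetweenSites_mem_torusLeftHalf_iff L j a hL _).2 hx⟩ : torusLeftHalf L j a) = x :=
        Subtype.ext (Torus.reflectBetweenSites_involutive j a (x : TorusSite d L))
      rw [hxx]

/-- **`A ↦ A ⊗ 1`**: operators of the left half act on the torus (tensor-square
identification pulled back to spin configurations of the torus). An algebra homomorphism.
[Bratteli–Robinson II §6.2.1 (isotony); Kennedy–Lieb–Shastry, J. Stat. Phys. 53 (1988), p. 1028]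
[folklore] -/
def torusLeftEmbed (hL : Even L) :
    Op (torusLeftHalf L j a) q →ₐ[ℂ] Op (TorusSite d L) q where
  toFun A := (A ⊗ₖ (1 : Op (torusLeftHalf L j a) q)).submatrix (torusSplit L j a hL)
    (torusSplit L j a hL)
  map_one' := by simp only [one_kronecker_one, submatrix_one_equiv]
  map_mul' A B := by
    rw [submatrix_mul_equiv, ← mul_kronecker_mul, Matrix.mul_one]
  map_zero' := by simp only [zero_kronecker, submatrix_zero, Pi.zero_apply]
  map_add' A B := by simp only [add_kronecker, submatrix_add, Pi.add_apply]
  commutes' c := by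
    simp only [Algebra.algebraMap_eq_smul_one, smul_kronecker, one_kronecker_one, submatrix_smul,
      Pi.smul_apply, submatrix_one_equiv]

/-- **`B ↦ 1 ⊗ B`**: operators of the left half act on the torus through the right half (read
through the reflection `θ`). An algebra homomorphism. [Bratteli–Robinson II §6.2.1;
Kennedy–Lieb–Shastry, J. Stat. Phys. 53 (1988), p. 1028] [folklore] -/
def torusRightEmbed (hL : Even L) :
    Op (torusLeftHalf L j a) q →ₐ[ℂ] Op (TorusSite d L) q where
  toFun B := ((1 : Op (torusLeftHalf L j a) q) ⊗ₖ B).submatrix (torusSplit L j a hL)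
    (torusSplit L j a hL)
  map_one' := by simp only [one_kronecker_one, submatrix_one_equiv]
  map_mul' A B := by
    rw [submatrix_mul_equiv, ← mul_kronecker_mul, Matrix.mul_one]
  map_zero' := by simp only [kronecker_zero, submatrix_zero, Pi.zero_apply]
  map_add' A B := by simp only [kronecker_add, submatrix_add, Pi.add_apply]
  commutes' c := by
    simp only [Algebra.algebraMap_eq_smul_one, kronecker_smul, one_kronecker_one, submatrix_smul,
      Pi.smul_apply, submatrix_one_equiv]

/-! ### The Kronecker form of the rotated field Hamiltonian -/

/-- The boundary layers of the left half: the sites `x` of the left half whose reflection `θx`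
is a nearest neighbour (the endpoints in the left half of the bonds crossing `P`).
[Kennedy–Lieb–Shastry, J. Stat. Phys. 53 (1988), p. 1028 ("We denote the bonds crossing P by
`{xᵢ yᵢ}` with `xᵢ` in the left half")] [cite: KLS1988JSP, p. 1028] -/
def torusCrossSites : Finset (TorusSite d L) :=
  (torusLeftHalf L j a).filter fun x => (torusGraph d L).Adj x (Torus.reflectBetweenSites j a x)

/-- The edges of the torus graph with both endpoints in the left half ("left bonds").
[cite: KLS1988JSP, p. 1027] -/
def torusLeftEdges : Finset (Sym2 (TorusSite d L)) :=
  (torusGraph d L).edgeFinset.filter fun e => ∀ x ∈ e, x ∈ torusLeftHalf L j a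

/-- **The left Hamiltonian `H^L`** on the state space of the left half: the bond terms of
`H♭(h)` of the left bonds plus the on-site terms `½h_x² - h_x T¹_x` of the left endpoints of the
crossing bonds (Kennedy–Lieb–Shastry, J. Stat. Phys. 53 (1988), p. 1028: "`H^L` … the sum of all
the terms … labeled by left bonds plus the terms `(T¹_x)² + (T²_x)² + (T³_x - h̄_x)²` from the
crossing bonds", here for the XY field Hamiltonian, where only the field-carrying component is
completed to a square). It depends on `h` only through `h|_left`. [cite: KLS1988JSP, eq. (21)] -/
def xyLeftHamiltonian (hL : Even L) (n : ℕ) (h : TorusSite d L → ℝ) :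
    Op (torusLeftHalf L j a) (n + 1) :=
  (∑ e ∈ torusLeftEdges L j a,
    Sym2.lift ⟨fun x y => xyRealBond n (fun z : torusLeftHalf L j a => h z)
        (torusToLeft L j a hL x) (torusToLeft L j a hL y), fun x y => by
      simp only [xyRealBond, spinBond_comm n _ (torusToLeft L j a hL x)]
      congr 2
      · rw [← neg_sub (h _) (h _), Complex.ofReal_neg, neg_smul, ← smul_neg, neg_sub]
      · rw [← neg_sub (h (torusToLeft L j a hL y)) (h _), neg_sq]⟩ e) +
  ∑ x ∈ torusCrossSites L j a,
    ((((h x) ^ 2 / 2 : ℝ) : ℂ) • (1 : Op (torusLeftHalf L j a) (n + 1)) -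
      ((h x : ℝ) : ℂ) • siteSpin n (torusToLeft L j a hL x) 0)

/-- **The crossing operators** `Mᵢ` of the Kronecker form `H^L ⊗ 1 + 1 ⊗ H^R - Σᵢ Mᵢ ⊗ Nᵢ`
(Kennedy–Lieb–Shastry, J. Stat. Phys. 53 (1988), eq. (21): `-2Σᵢ [T¹_{xᵢ}T¹_{yᵢ} + T²_{xᵢ}T²_{yᵢ}
+ (T³_{xᵢ} - h̄_{xᵢ})(T³_{yᵢ} - h̄_{yᵢ})]`, XY version with the field on the first
component): for a left endpoint `x` of a crossing bond, `M_{(x,0)} = T¹_x - h_x` and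
`M_{(x,1)} = T²_x = iS²_x` (real matrices); the partner `Nᵢ` is the same expression for the
reflected field `h ∘ θ`. [cite: KLS1988JSP, eq. (21)] -/
def xyCrossOp (hL : Even L) (n : ℕ) (h : TorusSite d L → ℝ) :
    torusCrossSites L j a × Bool → Op (torusLeftHalf L j a) (n + 1)
  | (x, false) => siteSpin n (torusToLeft L j a hL x) 0 -
      ((h x : ℝ) : ℂ) • (1 : Op (torusLeftHalf L j a) (n + 1))
  | (x, true) => Complex.I • siteSpin n (torusToLeft L j a hL x) 1

end Halves

end Literature.MathematicalPhysics.QuantumLattice
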